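import Mathlib
import Summits.ValiantsHypothesis.ValiantsHypothesis.Theorems.ValuativeGCTValuativeFlipPencilBorderChainSecond

/-!
# `stub_fourRowPencilRank` from ONE explicit statement: border ranks of the affine pattern
# (crux `ValuativeGCT.ValuativeFlip`, stmt-ValiantsHypothesis-12624; wall-breaker axis k8 gen 1)

Helper file (`--supports stmt-ValiantsHypothesis-12624`), line `four-row-count`.  The bordering chain
(`fourRowPencilRank_of_borderRanks2`, `…PencilBorderChainSecond`) specialised to the AFFINE PATTERN
  `b i j = (1, i, j, 0)` (the form `y₁ + i·y₂ + j·y₃`) for `i ≠ j`,   `b i i = (0, 0, 0, 1)` (`y₄`),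
base size `3` (`n₁ = 2`), corank allowance `L = 6`, and the four base cells `(0,0), (0,1), (1,0), (0,2)`
(coefficient vectors `(0,0,0,1), (1,0,1,0), (1,1,0,0), (1,0,2,0)`, determinant `-1`).  The ONLY remaining
hypothesis is the border-rank inequality `6N + 2 ≤ r₂(N) + 6` for THIS pattern (`N = 3 + k`), i.e. a
statement about the permanents of the zero-diagonal matrices `A_N = (y₁ + i y₂ + j y₃)·[i ≠ j]`:
numerically `r₂(N) = min(C(N+3,2), 8N+2)` for `N ≤ 19` and the `6N` forms `y_s·R_k, y_s·C_l` alone have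
rank `6N - 1` (single Laplace syzygy), seat folder `compute/pattern2.c`, `pattern3.c`; evidence
`border_rank_tables.md` on the item.  Proving that hypothesis closes the per-side heart of the head of
the crux (`stub_fourRowPencilRank`) outright.  [this crux, line four-row-count]
-/

set_option linter.dupNamespace false

namespace Summit.ValiantsHypothesis.ValiantsHypothesis.Theorems.ValuativeFlip

open scoped BigOperators Matrix
open MvPolynomial Literature.Computability.AlgebraicComplexity Literature.NumberTheory.DiophantineGeometry

/-- The four base cells of the affine pattern carry independent forms: the coefficient matrix of
`y₄, y₁+y₃, y₁+y₂, y₁+2y₃` has determinant `-1`. [this crux] -/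
theorem affinePattern_cells_isUnit :
    IsUnit (Matrix.of fun t t' : Fin 4 =>
      (fun i j : ℕ => (if i = j then (Pi.single (Fin.last 3) (1 : ℂ) : Fin 4 → ℂ) else ![(1 : ℂ), (i : ℂ), (j : ℂ), 0])) ((![((0 : Fin 3), (0 : Fin 3)), (0, 1), (1, 0), (0, 2)] t').1 : ℕ)
        ((![((0 : Fin 3), (0 : Fin 3)), (0, 1), (1, 0), (0, 2)] t').2 : ℕ) t) := by
  have h : (Matrix.of fun t t' : Fin 4 =>
      (fun i j : ℕ => (if i = j then (Pi.single (Fin.last 3) (1 : ℂ) : Fin 4 → ℂ) else ![(1 : ℂ), (i : ℂ), (j : ℂ), 0])) ((![((0 : Fin 3), (0 : Fin 3)), (0, 1), (1, 0), (0, 2)] t').1 : ℕ)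
        ((![((0 : Fin 3), (0 : Fin 3)), (0, 1), (1, 0), (0, 2)] t').2 : ℕ) t) =
      !![0, 1, 1, 1; 0, 0, 1, 0; 0, 1, 0, 2; 1, 0, 0, 0] := by
    ext t t'
    fin_cases t <;> fin_cases t' <;> simp [Fin.ext_iff]
  rw [h]
  refine ⟨⟨_, !![0, 0, 0, 1; 2, -2, -1, 0; 0, 1, 0, 0; -1, 1, 1, 0], ?_, ?_⟩, rfl⟩ <;>
  · ext i j
    fin_cases i <;> fin_cases j <;>
      simp [Matrix.mul_apply, Fin.sum_univ_four] <;> norm_num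

/-- **`stub_fourRowPencilRank` from the affine border-rank inequality.**  If the second-order border
ranks of the affine pattern satisfy `6N + 2 ≤ r₂(N) + 6` for every `N = 3 + k`, then the skeleton stub
`stub_fourRowPencilRank` of line `four-row-count` holds VERBATIM. [this crux, line four-row-count] -/
theorem fourRowPencilRank_of_affineBorderRanks
    (hr : ∀ k : ℕ, 6 * (2 + k + 1) + 2 ≤ Module.finrank ℂ ↥(
        Submodule.span ℂ (Set.range fun s : Fin 3 =>
          (X s : MvPolynomial (Fin 3) ℂ) *
            aeval (fun ij : Fin (2 + k + 1) × Fin (2 + k + 1) => ∑ s : Fin 3,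
                (if ((ij.1 : ℕ) = (ij.2 : ℕ) ∧ 2 + 1 ≤ (ij.1 : ℕ)) then (0 : ℂ) else (fun i j : ℕ => (if i = j then (Pi.single (Fin.last 3) (1 : ℂ) : Fin 4 → ℂ) else ![(1 : ℂ), (i : ℂ), (j : ℂ), 0])) ij.1 ij.2 (Fin.castSucc s)) •
                  (X s : MvPolynomial (Fin 3) ℂ))
              (perPoly (Fin (2 + k + 1)) ℂ))
        ⊔ Submodule.span ℂ (Set.range fun sk : Fin 3 × Fin (2 + k + 1) =>
          (X sk.1 : MvPolynomial (Fin 3) ℂ) *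
            ∑ l : Fin (2 + k + 1), (∑ s : Fin 3, (fun i j : ℕ => (if i = j then (Pi.single (Fin.last 3) (1 : ℂ) : Fin 4 → ℂ) else ![(1 : ℂ), (i : ℂ), (j : ℂ), 0])) (2 + k + 1) l (Fin.castSucc s) • (X s : MvPolynomial (Fin 3) ℂ)) *
              aeval (fun ij : Fin (2 + k + 1) × Fin (2 + k + 1) => ∑ s : Fin 3,
                  (if ((ij.1 : ℕ) = (ij.2 : ℕ) ∧ 2 + 1 ≤ (ij.1 : ℕ)) then (0 : ℂ) else (fun i j : ℕ => (if i = j then (Pi.single (Fin.last 3) (1 : ℂ) : Fin 4 → ℂ) else ![(1 : ℂ), (i : ℂ), (j : ℂ), 0])) ij.1 ij.2 (Fin.castSucc s)) •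
                    (X s : MvPolynomial (Fin 3) ℂ))
                (pderiv (sk.2, l) (perPoly (Fin (2 + k + 1)) ℂ)))
        ⊔ Submodule.span ℂ (Set.range fun sl : Fin 3 × Fin (2 + k + 1) =>
          (X sl.1 : MvPolynomial (Fin 3) ℂ) *
            ∑ k' : Fin (2 + k + 1), (∑ s : Fin 3, (fun i j : ℕ => (if i = j then (Pi.single (Fin.last 3) (1 : ℂ) : Fin 4 → ℂ) else ![(1 : ℂ), (i : ℂ), (j : ℂ), 0])) k' (2 + k + 1) (Fin.castSucc s) • (X s : MvPolynomial (Fin 3) ℂ)) *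
              aeval (fun ij : Fin (2 + k + 1) × Fin (2 + k + 1) => ∑ s : Fin 3,
                  (if ((ij.1 : ℕ) = (ij.2 : ℕ) ∧ 2 + 1 ≤ (ij.1 : ℕ)) then (0 : ℂ) else (fun i j : ℕ => (if i = j then (Pi.single (Fin.last 3) (1 : ℂ) : Fin 4 → ℂ) else ![(1 : ℂ), (i : ℂ), (j : ℂ), 0])) ij.1 ij.2 (Fin.castSucc s)) •
                    (X s : MvPolynomial (Fin 3) ℂ))
                (pderiv (k', sl.2) (perPoly (Fin (2 + k + 1)) ℂ)))
        ⊔ Submodule.span ℂ (Set.range fun k' : Fin (2 + k + 1) =>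
            ∑ l : Fin (2 + k + 1), (∑ s : Fin 3, (fun i j : ℕ => (if i = j then (Pi.single (Fin.last 3) (1 : ℂ) : Fin 4 → ℂ) else ![(1 : ℂ), (i : ℂ), (j : ℂ), 0])) (2 + k + 1) l (Fin.castSucc s) • (X s : MvPolynomial (Fin 3) ℂ)) *
              aeval (fun ij : Fin (2 + k + 2) × Fin (2 + k + 2) => ∑ s : Fin 3,
                  (if ((ij.1 : ℕ) = (ij.2 : ℕ) ∧ 2 + 1 ≤ (ij.1 : ℕ)) then (0 : ℂ) else (fun i j : ℕ => (if i = j then (Pi.single (Fin.last 3) (1 : ℂ) : Fin 4 → ℂ) else ![(1 : ℂ), (i : ℂ), (j : ℂ), 0])) ij.1 ij.2 (Fin.castSucc s)) •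
                    (X s : MvPolynomial (Fin 3) ℂ))
                (pderiv (Fin.castSucc k', Fin.castSucc l) (perPoly (Fin (2 + k + 2)) ℂ)))
        ⊔ Submodule.span ℂ (Set.range fun l : Fin (2 + k + 1) =>
            ∑ k' : Fin (2 + k + 1), (∑ s : Fin 3, (fun i j : ℕ => (if i = j then (Pi.single (Fin.last 3) (1 : ℂ) : Fin 4 → ℂ) else ![(1 : ℂ), (i : ℂ), (j : ℂ), 0])) k' (2 + k + 1) (Fin.castSucc s) • (X s : MvPolynomial (Fin 3) ℂ)) *
              aeval (fun ij : Fin (2 + k + 2) × Fin (2 + k + 2) => ∑ s : Fin 3,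
                  (if ((ij.1 : ℕ) = (ij.2 : ℕ) ∧ 2 + 1 ≤ (ij.1 : ℕ)) then (0 : ℂ) else (fun i j : ℕ => (if i = j then (Pi.single (Fin.last 3) (1 : ℂ) : Fin 4 → ℂ) else ![(1 : ℂ), (i : ℂ), (j : ℂ), 0])) ij.1 ij.2 (Fin.castSucc s)) •
                    (X s : MvPolynomial (Fin 3) ℂ))
                (pderiv (Fin.castSucc k', Fin.castSucc l) (perPoly (Fin (2 + k + 2)) ℂ)))) + 6) :
    ∃ n₀ : ℕ, ∀ n ≥ n₀, ∀ (m : ℕ) [NeZero m], n ≤ m → 5 * m ≤ 6 * n →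
      ∃ g : GL (MatIdx m) ℂ, 2 * m ^ 2 + m + 2 ≤ Module.finrank ℂ ↥(Submodule.span ℂ (Set.range fun ab : {a : MatIdx m // m * m ≤ (((matIdxEquiv m).symm a : Fin (m * m)) : ℕ) + 4} × MatIdx m => (MvPolynomial.X ab.1.1 : MvPolynomial (MatIdx m) ℂ) * MvPolynomial.aeval (fun i : MatIdx m => if m * m ≤ (((matIdxEquiv m).symm i : Fin (m * m)) : ℕ) + 4 then (MvPolynomial.X i : MvPolynomial (MatIdx m) ℂ) else 0) (MvPolynomial.pderiv ab.2 (linSubst (MatIdx m) ℂ ((g : GL (MatIdx m) ℂ) : Matrix (MatIdx m) (MatIdx m) ℂ) (paddedPerFormLex ℂ n m))))) :=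
  fourRowPencilRank_of_borderRanks2 2 (fun i j : ℕ => (if i = j then (Pi.single (Fin.last 3) (1 : ℂ) : Fin 4 → ℂ) else ![(1 : ℂ), (i : ℂ), (j : ℂ), 0]))
    ![((0 : Fin 3), (0 : Fin 3)), (0, 1), (1, 0), (0, 2)] affinePattern_cells_isUnit 6 hr

end Summit.ValiantsHypothesis.ValiantsHypothesis.Theorems.ValuativeFlip
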